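import Mathlib
import Literature.Analysis.FunctionSpaces.LatticeConvolution
import HarnessLib

/-!
# The lattice product law `H² · H² → H¹` for the convective term, with the explicit constant `2σ` (instab g12, cell `ns-blowup`, 2026-08-26)

HONEST FRAMING (human ruling D-0035): nothing here is a claim about Navier–Stokes blow-up.
WHAT THIS IS NOT: not NS evidence — lattice (`ℤ^d`, Fourier-side) inequalities between `ℝ≥0∞`
sums, Mathlib + the tree's `LatticeConvolution` only. It is the kernel form of the displayed constant
`c_alg` of the R-β emergence chain (`HOME/instab/C-ALG-DISPLAY.md`, INSTAB-BRIDGE §13 l.126 (b)(ii)):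
the bilinear loss `‖ℙ[(v·∇)w]‖_{H¹} ≤ c_alg ‖v‖_{H²} ‖w‖_{H²}` read on the absolute values of Fourier
coefficients.

With a weight `w : ℤ^d → (0, ∞)` that is SUBADDITIVE, `w(k) ≤ w(k - l) + w(l)` (the Japanese
bracket `⟨k⟩ = (1 + |k|²)^{1/2}` of `Torus.sobolevWeight 1` is: it is the Euclidean length of
`(1, k) ∈ ℝ^{1+d}`), and coefficient sizes `v, u, f ≥ 0` with the CONVECTIVE DOMINATION
`f(k) ≤ ∑_l v(k - l) · (w(l) u(l))` (for `f = ((v·∇)u)^` this is `|q·v̂(p)| ≤ |v̂(p)||q|` and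
`|q| ≤ ⟨q⟩`), one has

  `∑_k (w(k) f(k))² ≤ 4 σ² · (∑_l (w(l)² v(l))²) · (∑_l (w(l)² u(l))²)`,  `σ² = ∑_l w(l)⁻⁴`

(`weighted_tsum_sq_le_of_convective_domination`), i.e. `‖f‖_{H¹} ≤ 2σ ‖v‖_{H²} ‖u‖_{H²}`; in the
tree's lattice Sobolev vocabulary (`Lattice.eNormSq s`, weight `Torus.sobolevWeight`):
`eNormSq 1 f ≤ 4 (∑_l ⟨l⟩⁻⁴) · eNormSq 2 v · eNormSq 2 u` (`eNormSq_one_le_of_convective_domination`).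
PROOF (six lines, `C-ALG-DISPLAY.md` §2): subadditivity splits `w(k) f(k) ≤ A_k + B_k` with
`A_k = ∑_l (w v)(k-l) (w u)(l) = ∑_l (r a)(k-l) (r b)(l)` and `B_k = ∑_l v(k-l) (w² u)(l) = ∑_l (r² a)(k-l) b(l)`
(`a = w² v`, `b = w² u`, `r = w⁻¹`); TERM A by Cauchy–Schwarz twice and Tonelli
(`∑_l r(k-l)² r(l)² ≤ σ²` uniformly in `k`, `tsum_sq_sub_mul_sq_le`; `tsum_sq_convA_le`), TERM B by
Young `ℓ¹ ⋆ ℓ² ⊂ ℓ²` (`Lattice.young_sq`) and Cauchy–Schwarz (`tsum_sq_convB_le`), then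
`(A + B)² ≤ 2A² + 2B²`. No Sobolev-embedding constant enters (the loss `H² × H² → H¹` leaves
`s + t − n/2 = 5/2 > 1` of room in `d = 3`; contrast the borderline `H¹ · H¹ ⊂ H^{1/2}` of the tree's
`TorusLatticeProductLaw`, which needs the resolvent lattice sum). The value of `σ²` is not bounded here
(for `⟨k⟩² = κ² + |k|²` on `ℤ³` Poisson summation gives `σ² = (π²/κ)(1 + O(e^{−2πκ}))`, memo §3; its
finiteness for `card d ≤ 3` is `Torus.summable_one_add_freqNormSq_rpow_neg_of_lt`).

Tools landed on the way: plain Cauchy–Schwarz for `tsum` in `ℝ≥0∞` (`sq_tsum_mul_le_tsum_sq_mul_tsum_sq`;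
the tree's `Lattice.sq_tsum_mul_le` is the weighted form), the subadditivity of `⟨·⟩`
(`sobolevWeight_one_le_sub_add`).
-/

noncomputable section

namespace Summit.NavierStokesRegularity.FluidComputer.ConvectiveProductLawLattice

open Literature.Analysis.FunctionSpaces Literature.Analysis.FunctionSpaces.Lattice
open Literature.Analysis.FunctionSpaces.Torus
open scoped ENNReal NNReal

variable {d : Type*}

/-! ## Cauchy–Schwarz for unconditional sums in `ℝ≥0∞` -/

/-- **Cauchy–Schwarz for `tsum` in `ℝ≥0∞`** (unconditional, no summability hypotheses):
`(∑ x y)² ≤ (∑ x²)(∑ y²)`, from `2(x_l y_m)(x_m y_l) ≤ (x_l y_m)² + (x_m y_l)²` summed over `l, m`. -/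
theorem sq_tsum_mul_le_tsum_sq_mul_tsum_sq {ι : Type*} (x y : ι → ℝ≥0∞) :
    (∑' l, x l * y l) ^ 2 ≤ (∑' l, x l ^ 2) * ∑' l, y l ^ 2 := by
  have h2 : (2 : ℝ≥0∞) ≠ 0 := two_ne_zero
  have h2' : (2 : ℝ≥0∞) ≠ ∞ := ENNReal.ofNat_ne_top
  refine (ENNReal.mul_le_mul_iff_right h2 h2').1 ?_
  calc 2 * (∑' l, x l * y l) ^ 2
      = ∑' l, ∑' m, 2 * ((x l * y l) * (x m * y m)) := by
        rw [sq, ennreal_tsum_mul_tsum, ← ENNReal.tsum_mul_left]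
        exact tsum_congr fun l => (ENNReal.tsum_mul_left).symm
    _ ≤ ∑' l, ∑' m, (x l ^ 2 * y m ^ 2 + x m ^ 2 * y l ^ 2) :=
        ENNReal.tsum_le_tsum fun l => ENNReal.tsum_le_tsum fun m => by
          calc 2 * ((x l * y l) * (x m * y m)) = 2 * (x l * y m) * (x m * y l) := by ring
            _ ≤ (x l * y m) ^ 2 + (x m * y l) ^ 2 := ennreal_two_mul_le_add_sq _ _
            _ = x l ^ 2 * y m ^ 2 + x m ^ 2 * y l ^ 2 := by ring
    _ = (∑' l, ∑' m, x l ^ 2 * y m ^ 2) + ∑' l, ∑' m, x m ^ 2 * y l ^ 2 := by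
        rw [← ENNReal.tsum_add]
        exact tsum_congr fun l => ENNReal.tsum_add
    _ = (∑' l, x l ^ 2) * (∑' m, y m ^ 2) + (∑' m, x m ^ 2) * ∑' l, y l ^ 2 := by
        congr 1
        · exact (ennreal_tsum_mul_tsum _ _).symm
        · rw [ENNReal.tsum_comm]
          exact (ennreal_tsum_mul_tsum _ _).symm
    _ = 2 * ((∑' l, x l ^ 2) * ∑' l, y l ^ 2) := by rw [two_mul]

/-- `(x²)² = x⁴`. -/
theorem sq_sq_eq_pow_four {M : Type*} [Monoid M] (x : M) : (x ^ 2) ^ 2 = x ^ 4 := by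
  rw [← pow_mul]

/-- `x² ≤ 2A² + 2B²` whenever `x ≤ A + B` (in `ℝ≥0∞`). -/
theorem sq_le_two_mul_sq_add {x A B : ℝ≥0∞} (h : x ≤ A + B) :
    x ^ 2 ≤ 2 * A ^ 2 + 2 * B ^ 2 := by
  calc x ^ 2 ≤ (A + B) ^ 2 := by gcongr
    _ = A ^ 2 + B ^ 2 + 2 * A * B := by ring
    _ ≤ A ^ 2 + B ^ 2 + (A ^ 2 + B ^ 2) := by gcongr ?_ + ?_; exacts [le_rfl, ennreal_two_mul_le_add_sq A B]
    _ = 2 * A ^ 2 + 2 * B ^ 2 := by ring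

/-! ## The kernel bound and the two convolution terms -/

/-- **The kernel bound, uniformly in the centre**: `∑_l r(k - l)² r(l)² ≤ ∑_l r(l)⁴`
(Cauchy–Schwarz and translation invariance). This is the whole harmonic-analysis input of the
`H² · H² → H¹` law — no decay in `k` is needed, unlike the borderline product laws. -/
theorem tsum_sq_sub_mul_sq_le (r : (d → ℤ) → ℝ≥0∞) (k : d → ℤ) :
    ∑' l, r (k - l) ^ 2 * r l ^ 2 ≤ ∑' l, r l ^ 4 := by
  have h := sq_tsum_mul_le_tsum_sq_mul_tsum_sq (fun l => r (k - l) ^ 2) (fun l => r l ^ 2)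
  have h1 : ∑' l, (r (k - l) ^ 2) ^ 2 = ∑' l, r l ^ 4 := by
    rw [show (∑' l, (r (k - l) ^ 2) ^ 2) = ∑' l, r (k - l) ^ 4 from
      tsum_congr fun l => sq_sq_eq_pow_four _]
    exact tsum_sub_left_eq (fun l => r l ^ 4) k
  have h2 : ∑' l, (r l ^ 2) ^ 2 = ∑' l, r l ^ 4 := tsum_congr fun l => sq_sq_eq_pow_four _
  simp only [h1, h2] at h
  rw [← sq] at h
  exact (ENNReal.pow_le_pow_left_iff two_ne_zero).1 h

/-- **TERM A** (Cauchy–Schwarz twice, Tonelli, translation invariance):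
`∑_k (∑_l (r a)(k-l) · (r b)(l))² ≤ (∑ r⁴) (∑ a²) (∑ b²)`. -/
theorem tsum_sq_convA_le (r a b : (d → ℤ) → ℝ≥0∞) :
    ∑' k, (∑' l, (r (k - l) * a (k - l)) * (r l * b l)) ^ 2 ≤
      (∑' l, r l ^ 4) * ((∑' l, a l ^ 2) * ∑' l, b l ^ 2) := by
  calc ∑' k, (∑' l, (r (k - l) * a (k - l)) * (r l * b l)) ^ 2
      = ∑' k, (∑' l, (r (k - l) * r l) * (a (k - l) * b l)) ^ 2 := by
        refine tsum_congr fun k => ?_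
        congr 1
        exact tsum_congr fun l => by ring
    _ ≤ ∑' k, (∑' l, (r (k - l) * r l) ^ 2) * ∑' l, (a (k - l) * b l) ^ 2 :=
        ENNReal.tsum_le_tsum fun k => sq_tsum_mul_le_tsum_sq_mul_tsum_sq _ _
    _ ≤ ∑' k, (∑' l, r l ^ 4) * ∑' l, a (k - l) ^ 2 * b l ^ 2 := by
        refine ENNReal.tsum_le_tsum fun k => ?_
        have hA : ∑' l, (r (k - l) * r l) ^ 2 ≤ ∑' l, r l ^ 4 := by
          calc ∑' l, (r (k - l) * r l) ^ 2 = ∑' l, r (k - l) ^ 2 * r l ^ 2 :=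
                tsum_congr fun l => by rw [mul_pow]
            _ ≤ ∑' l, r l ^ 4 := tsum_sq_sub_mul_sq_le r k
        have hB : ∑' l, (a (k - l) * b l) ^ 2 = ∑' l, a (k - l) ^ 2 * b l ^ 2 :=
          tsum_congr fun l => by rw [mul_pow]
        rw [hB]
        exact mul_le_mul_left hA _
    _ = (∑' l, r l ^ 4) * ∑' k, ∑' l, a (k - l) ^ 2 * b l ^ 2 := ENNReal.tsum_mul_left
    _ = (∑' l, r l ^ 4) * ((∑' l, a l ^ 2) * ∑' l, b l ^ 2) := by
        congr 1
        rw [ENNReal.tsum_comm]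
        calc ∑' l, ∑' k, a (k - l) ^ 2 * b l ^ 2 = ∑' l, (∑' k, a (k - l) ^ 2) * b l ^ 2 :=
              tsum_congr fun l => ENNReal.tsum_mul_right
          _ = ∑' l, (∑' k, a k ^ 2) * b l ^ 2 :=
              tsum_congr fun l => by rw [tsum_sub_right_eq (fun k => a k ^ 2) l]
          _ = (∑' l, a l ^ 2) * ∑' l, b l ^ 2 := ENNReal.tsum_mul_left

/-- **TERM B** (Young `ℓ¹ ⋆ ℓ² ⊂ ℓ²`, then Cauchy–Schwarz for the `ℓ¹` norm):
`∑_k (∑_l (r² a)(k-l) · b(l))² ≤ (∑ r⁴) (∑ a²) (∑ b²)`. -/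
theorem tsum_sq_convB_le (r a b : (d → ℤ) → ℝ≥0∞) :
    ∑' k, (∑' l, (r (k - l) ^ 2 * a (k - l)) * b l) ^ 2 ≤
      (∑' l, r l ^ 4) * ((∑' l, a l ^ 2) * ∑' l, b l ^ 2) := by
  have hy : ∑' k, (∑' l, (r (k - l) ^ 2 * a (k - l)) * b l) ^ 2 ≤
      (∑' k, r k ^ 2 * a k) ^ 2 * ∑' l, b l ^ 2 := young_sq (fun l => r l ^ 2 * a l) b
  have hcs : (∑' k, r k ^ 2 * a k) ^ 2 ≤ (∑' k, r k ^ 4) * ∑' k, a k ^ 2 := by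
    have h := sq_tsum_mul_le_tsum_sq_mul_tsum_sq (fun k => r k ^ 2) a
    have h4 : ∑' k, (r k ^ 2) ^ 2 = ∑' k, r k ^ 4 := tsum_congr fun k => sq_sq_eq_pow_four _
    rwa [h4] at h
  calc _ ≤ (∑' k, r k ^ 2 * a k) ^ 2 * ∑' l, b l ^ 2 := hy
    _ ≤ ((∑' k, r k ^ 4) * ∑' k, a k ^ 2) * ∑' l, b l ^ 2 := mul_le_mul_left hcs _
    _ = (∑' l, r l ^ 4) * ((∑' l, a l ^ 2) * ∑' l, b l ^ 2) := by rw [mul_assoc]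

/-- **Abstract form**: if `g(k) ≤ A_k + B_k` with the two convolution terms above, then
`∑ g² ≤ 4 (∑ r⁴) (∑ a²) (∑ b²)`. -/
theorem tsum_sq_le_four_mul_of_le_convA_add_convB (r a b g : (d → ℤ) → ℝ≥0∞)
    (hg : ∀ k, g k ≤ (∑' l, (r (k - l) * a (k - l)) * (r l * b l))
      + ∑' l, (r (k - l) ^ 2 * a (k - l)) * b l) :
    ∑' k, g k ^ 2 ≤ 4 * (∑' l, r l ^ 4) * ((∑' l, a l ^ 2) * ∑' l, b l ^ 2) := by
  calc ∑' k, g k ^ 2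
      ≤ ∑' k, (2 * (∑' l, (r (k - l) * a (k - l)) * (r l * b l)) ^ 2
          + 2 * (∑' l, (r (k - l) ^ 2 * a (k - l)) * b l) ^ 2) :=
        ENNReal.tsum_le_tsum fun k => sq_le_two_mul_sq_add (hg k)
    _ = 2 * ∑' k, (∑' l, (r (k - l) * a (k - l)) * (r l * b l)) ^ 2
          + 2 * ∑' k, (∑' l, (r (k - l) ^ 2 * a (k - l)) * b l) ^ 2 := by
        rw [ENNReal.tsum_add, ENNReal.tsum_mul_left, ENNReal.tsum_mul_left]
    _ ≤ 2 * ((∑' l, r l ^ 4) * ((∑' l, a l ^ 2) * ∑' l, b l ^ 2))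
          + 2 * ((∑' l, r l ^ 4) * ((∑' l, a l ^ 2) * ∑' l, b l ^ 2)) := by
        gcongr
        · exact tsum_sq_convA_le r a b
        · exact tsum_sq_convB_le r a b
    _ = 4 * (∑' l, r l ^ 4) * ((∑' l, a l ^ 2) * ∑' l, b l ^ 2) := by ring

/-! ## The weighted form: subadditive weight + convective domination -/

/-- **The convective product law `H² · H² → H¹`, abstract weight**: for a weight
`0 < w < ∞` with `w(k) ≤ w(k-l) + w(l)` and sizes with `f(k) ≤ ∑_l v(k-l) (w(l) u(l))`,
`∑_k (w f)(k)² ≤ 4 (∑ w⁻⁴) (∑ (w² v)²) (∑ (w² u)²)`, i.e. `‖f‖_{1} ≤ 2σ ‖v‖_{2} ‖u‖_{2}` with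
`σ² = ∑ w⁻⁴`. -/
theorem weighted_tsum_sq_le_of_convective_domination (w v u f : (d → ℤ) → ℝ≥0∞)
    (hw0 : ∀ k, w k ≠ 0) (hwt : ∀ k, w k ≠ ∞) (hsub : ∀ k l, w k ≤ w (k - l) + w l)
    (hf : ∀ k, f k ≤ ∑' l, v (k - l) * (w l * u l)) :
    ∑' k, (w k * f k) ^ 2 ≤
      4 * (∑' l, (w l)⁻¹ ^ 4) * ((∑' l, (w l ^ 2 * v l) ^ 2) * ∑' l, (w l ^ 2 * u l) ^ 2) := by
  refine tsum_sq_le_four_mul_of_le_convA_add_convB (fun l => (w l)⁻¹) (fun l => w l ^ 2 * v l)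
    (fun l => w l ^ 2 * u l) (fun k => w k * f k) fun k => ?_
  have hwinv : ∀ l, (w l)⁻¹ * w l = 1 := fun l => ENNReal.inv_mul_cancel (hw0 l) (hwt l)
  have e1 : ∀ l, (w l)⁻¹ * (w l ^ 2 * v l) = w l * v l := fun l => by
    rw [sq, ← mul_assoc, ← mul_assoc, hwinv, one_mul]
  have e2 : ∀ l, (w l)⁻¹ * (w l ^ 2 * u l) = w l * u l := fun l => by
    rw [sq, ← mul_assoc, ← mul_assoc, hwinv, one_mul]
  have e3 : ∀ l, (w l)⁻¹ ^ 2 * (w l ^ 2 * v l) = v l := fun l => by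
    rw [← mul_assoc, ← mul_pow, hwinv, one_pow, one_mul]
  calc w k * f k ≤ w k * ∑' l, v (k - l) * (w l * u l) := by gcongr; exact hf k
    _ = ∑' l, w k * (v (k - l) * (w l * u l)) := by rw [← ENNReal.tsum_mul_left]
    _ ≤ ∑' l, (w (k - l) + w l) * (v (k - l) * (w l * u l)) :=
        ENNReal.tsum_le_tsum fun l => mul_le_mul_left (hsub k l) _
    _ = ∑' l, ((w (k - l))⁻¹ * (w (k - l) ^ 2 * v (k - l)) * ((w l)⁻¹ * (w l ^ 2 * u l))
          + (w (k - l))⁻¹ ^ 2 * (w (k - l) ^ 2 * v (k - l)) * (w l ^ 2 * u l)) :=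
        tsum_congr fun l => by rw [e1, e2, e3]; ring
    _ = (∑' l, (w (k - l))⁻¹ * (w (k - l) ^ 2 * v (k - l)) * ((w l)⁻¹ * (w l ^ 2 * u l)))
          + ∑' l, (w (k - l))⁻¹ ^ 2 * (w (k - l) ^ 2 * v (k - l)) * (w l ^ 2 * u l) :=
        ENNReal.tsum_add

/-! ## The instance `w = ⟨·⟩` of the tree's lattice Sobolev scale -/

section Bracket

variable [Fintype d]

/-- Discrete Cauchy–Schwarz in the form used below: `∑ᵢ aᵢ bᵢ ≤ √(∑ aᵢ²) √(∑ bᵢ²)`. -/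
theorem sum_mul_le_sqrt_mul_sqrt (a b : d → ℝ) :
    ∑ i, a i * b i ≤ Real.sqrt (∑ i, a i ^ 2) * Real.sqrt (∑ i, b i ^ 2) := by
  have h := Finset.sum_mul_sq_le_sq_mul_sq Finset.univ a b
  have ha : 0 ≤ ∑ i, a i ^ 2 := Finset.sum_nonneg fun i _ => sq_nonneg _
  rw [← Real.sqrt_mul ha]
  calc ∑ i, a i * b i ≤ |∑ i, a i * b i| := le_abs_self _
    _ = Real.sqrt ((∑ i, a i * b i) ^ 2) := (Real.sqrt_sq_eq_abs _).symm
    _ ≤ Real.sqrt ((∑ i, a i ^ 2) * ∑ i, b i ^ 2) := Real.sqrt_le_sqrt h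

/-- `⟨k⟩ = √(1 + |k|²)` for the weight of order one. -/
theorem sobolevWeight_one_eq_sqrt (k : d → ℤ) :
    sobolevWeight 1 k = Real.sqrt (1 + freqNormSq k) := by
  rw [sobolevWeight, Real.sqrt_eq_rpow]

/-- `|p + q|² ≤ |p|² + |q|² + 2 √(1+|p|²) √(1+|q|²)` on `ℤ^d`. -/
theorem freqNormSq_add_le (p q : d → ℤ) :
    freqNormSq (p + q) ≤ freqNormSq p + freqNormSq q
      + 2 * (Real.sqrt (1 + freqNormSq p) * Real.sqrt (1 + freqNormSq q)) := by
  have hcs := sum_mul_le_sqrt_mul_sqrt (fun i => (p i : ℝ)) (fun i => (q i : ℝ))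
  have hp : Real.sqrt (∑ i, (p i : ℝ) ^ 2) ≤ Real.sqrt (1 + freqNormSq p) :=
    Real.sqrt_le_sqrt (by rw [freqNormSq]; linarith)
  have hq : Real.sqrt (∑ i, (q i : ℝ) ^ 2) ≤ Real.sqrt (1 + freqNormSq q) :=
    Real.sqrt_le_sqrt (by rw [freqNormSq]; linarith)
  have hpq : ∑ i, (p i : ℝ) * (q i : ℝ) ≤ Real.sqrt (1 + freqNormSq p) * Real.sqrt (1 + freqNormSq q) :=
    hcs.trans (mul_le_mul hp hq (Real.sqrt_nonneg _) (Real.sqrt_nonneg _))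
  have hexp : freqNormSq (p + q) = freqNormSq p + freqNormSq q + 2 * ∑ i, (p i : ℝ) * (q i : ℝ) := by
    simp only [freqNormSq, Pi.add_apply, Int.cast_add, Finset.mul_sum, ← Finset.sum_add_distrib]
    exact Finset.sum_congr rfl fun i _ => by ring
  rw [hexp]
  linarith

/-- **Subadditivity of the Japanese bracket**: `⟨k⟩ ≤ ⟨k - l⟩ + ⟨l⟩` (`⟨k⟩` is the Euclidean
length of `(1, k)`; squared: `1 + |k|² ≤ 2 + |k-l|² + |l|² + 2⟨k-l⟩⟨l⟩`). -/
theorem sobolevWeight_one_le_sub_add (k l : d → ℤ) :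
    sobolevWeight 1 k ≤ sobolevWeight 1 (k - l) + sobolevWeight 1 l := by
  rw [sobolevWeight_one_eq_sqrt, sobolevWeight_one_eq_sqrt, sobolevWeight_one_eq_sqrt]
  have hA : 0 ≤ Real.sqrt (1 + freqNormSq (k - l)) := Real.sqrt_nonneg _
  have hB : 0 ≤ Real.sqrt (1 + freqNormSq l) := Real.sqrt_nonneg _
  have hA2 : Real.sqrt (1 + freqNormSq (k - l)) ^ 2 = 1 + freqNormSq (k - l) :=
    Real.sq_sqrt (by linarith [freqNormSq_nonneg (k - l)])
  have hB2 : Real.sqrt (1 + freqNormSq l) ^ 2 = 1 + freqNormSq l :=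
    Real.sq_sqrt (by linarith [freqNormSq_nonneg l])
  have hk : freqNormSq k ≤ freqNormSq (k - l) + freqNormSq l
      + 2 * (Real.sqrt (1 + freqNormSq (k - l)) * Real.sqrt (1 + freqNormSq l)) := by
    have := freqNormSq_add_le (k - l) l
    rwa [sub_add_cancel] at this
  rw [Real.sqrt_le_left (by positivity)]
  nlinarith [hA2, hB2, hk, mul_nonneg hA hB]

end Bracket

section Instance

variable [Fintype d]
variable {E F G : Type*} [NormedAddCommGroup E] [NormedAddCommGroup F] [NormedAddCommGroup G]

/-- `(⟨k⟩⁻¹)⁴ = ⟨k⟩^{-2}²` in `ℝ≥0∞` (the summand of `σ²`). -/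
theorem ofReal_sobolevWeight_inv_pow_four (k : d → ℤ) :
    (ENNReal.ofReal (sobolevWeight 1 k))⁻¹ ^ 4 = ENNReal.ofReal (sobolevWeight (-2) k ^ 2) := by
  rw [← ENNReal.ofReal_inv_of_pos (sobolevWeight_pos 1 k), ← sobolevWeight_neg,
    ← ENNReal.ofReal_pow (sobolevWeight_pos _ _).le]
  congr 1
  rw [show (4 : ℕ) = 2 * 2 from rfl, pow_mul, ← show sobolevWeight (-2) k = sobolevWeight (-1) k ^ 2 by
    rw [sq, ← sobolevWeight_add]; norm_num]

/-- `(⟨k⟩²)² = ⟨k⟩₂²` in `ℝ≥0∞` (the `H²` weight). -/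
theorem ofReal_sobolevWeight_sq_sq (k : d → ℤ) :
    (ENNReal.ofReal (sobolevWeight 1 k) ^ 2) ^ 2 = ENNReal.ofReal (sobolevWeight 2 k ^ 2) := by
  rw [← ENNReal.ofReal_pow (sobolevWeight_pos _ _).le, ← ENNReal.ofReal_pow (by positivity)]
  congr 1
  rw [← show sobolevWeight 2 k = sobolevWeight 1 k ^ 2 by rw [sq, ← sobolevWeight_add]; norm_num]

/-- **The convective product law `H² · H² → H¹` on the lattice Sobolev scale, explicit constant**
(kernel form of `c_alg = 2σ`, `C-ALG-DISPLAY.md` §1–§2): if the coefficient family `cf` is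
CONVECTIVELY DOMINATED by `cv, cw`, `‖cf k‖ ≤ ∑_l ‖cv(k-l)‖ · ⟨l⟩ · ‖cw l‖` (as `((v·∇)w)^` is by
`v̂, ŵ` up to the torus' `2π`), then
`‖cf‖²_{H¹} ≤ 4 σ² ‖cv‖²_{H²} ‖cw‖²_{H²}` with `σ² = ∑_l ⟨l⟩⁻⁴`. -/
theorem eNormSq_one_le_of_convective_domination (cv : (d → ℤ) → E) (cw : (d → ℤ) → F)
    (cf : (d → ℤ) → G)
    (hdom : ∀ k, ‖cf k‖ₑ ≤ ∑' l, ‖cv (k - l)‖ₑ * (ENNReal.ofReal (sobolevWeight 1 l) * ‖cw l‖ₑ)) :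
    eNormSq 1 cf ≤ 4 * (∑' l : d → ℤ, ENNReal.ofReal (sobolevWeight (-2) l ^ 2)) *
      (eNormSq 2 cv * eNormSq 2 cw) := by
  have h := weighted_tsum_sq_le_of_convective_domination
    (fun k => ENNReal.ofReal (sobolevWeight 1 k)) (fun k => ‖cv k‖ₑ) (fun k => ‖cw k‖ₑ)
    (fun k => ‖cf k‖ₑ) (fun k => (ENNReal.ofReal_pos.2 (sobolevWeight_pos 1 k)).ne')
    (fun k => ENNReal.ofReal_ne_top)
    (fun k l => by
      rw [← ENNReal.ofReal_add (sobolevWeight_pos _ _).le (sobolevWeight_pos _ _).le]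
      exact ENNReal.ofReal_le_ofReal (sobolevWeight_one_le_sub_add k l))
    hdom
  have hL : eNormSq 1 cf = ∑' k, (ENNReal.ofReal (sobolevWeight 1 k) * ‖cf k‖ₑ) ^ 2 := by
    refine tsum_congr fun k => ?_
    rw [mul_pow, ← ENNReal.ofReal_pow (sobolevWeight_pos _ _).le]
  have hσ : ∑' l : d → ℤ, (ENNReal.ofReal (sobolevWeight 1 l))⁻¹ ^ 4 =
      ∑' l : d → ℤ, ENNReal.ofReal (sobolevWeight (-2) l ^ 2) :=
    tsum_congr fun l => ofReal_sobolevWeight_inv_pow_four l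
  have hv : ∑' l, (ENNReal.ofReal (sobolevWeight 1 l) ^ 2 * ‖cv l‖ₑ) ^ 2 = eNormSq 2 cv := by
    refine tsum_congr fun l => ?_
    rw [mul_pow, ofReal_sobolevWeight_sq_sq]
  have hw : ∑' l, (ENNReal.ofReal (sobolevWeight 1 l) ^ 2 * ‖cw l‖ₑ) ^ 2 = eNormSq 2 cw := by
    refine tsum_congr fun l => ?_
    rw [mul_pow, ofReal_sobolevWeight_sq_sq]
  rw [hL, ← hσ, ← hv, ← hw]
  exact h

end Instance

end Summit.NavierStokesRegularity.FluidComputer.ConvectiveProductLawLattice
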